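import Summits.QuantumFields.GaugeBoot.TiltedFrameNoGo
import Summits.QuantumFields.GaugeBoot.TiltedLinkRPGeometry
import Summits.QuantumFields.GaugeBoot.PeriodicLoopEquationInstances
import Literature.MathematicalPhysics.QuantumFieldTheory.ConstructiveQFTWave0SiteRPProofs
import HarnessLib

/-!
# The cubic torus in the frame theory: site frames along every axis iff the side is even `≥ 4`
# (gauge-boot, L3 structural supplement, part 1 of 2)

HONEST FRAMING (cell `pub-gaugeboot`, page 1 of every file): the venture produces certified bounds
on lattice expectations at stated coupling, gauge group, dimension and torus size; NOT a mass gap,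
NOT a continuum limit, NOT a string tension; NOT Yang–Mills-summit-bearing (barriers
`FixedCouplingUltralocality`, `PerturbativeInvisibility`). This module bounds no expectation: it
instantiates the lane's reflection mechanisms on the volume of record of the certificates.

The frame theory of the lane (`TiltedSiteRPGeometry.lean` … `TiltedLinkRPPositivity.lean`,
`TiltedFrameNoGo.lean`, `PeriodicBoxSiteFrames.lean`) was instantiated on the 45°-tilted box
(`TiltedBoxSiteRP.lean`, `TiltedBoxLinkRP.lean`) and on the doubly tilted box
(`DoublyTiltedBox.lean`); on the CUBIC TORUS `(ℤ/L)^d = Site d L` — the tree's `GaugeConfig d L`,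
the volume of every certificate of the cell — only the negative side was recorded
(`not_isTiltedFrame_cubicTorus`: no diagonal frame, any `L`). This file records the positive side
and closes the classification on the cubic torus:

* `isSiteFrame_cubicTorus` — for `L = 2Q`, `Q ≥ 2`, and EVERY axis `k`, the coordinate reflection
  `x_k ↦ -x_k` (`cubicAxisReflect`) and the coordinate `x ↦ x_k` (`cubicAxisCoord`) form a site frame
  for the marked translations `cubicUnit d L` (`PeriodicLoopEquationInstances.lean`);
* `exists_isSiteFrame_cubicTorus_iff` — **classification**: `(ℤ/L)^d` carries a site frame along
  `k` with half period `Q` (for SOME additive reflection and SOME height) iff `Q ≥ 2 ∧ L = 2Q`. So the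
  Osterwalder–Seiler frame mechanism for Kazakov–Zheng's site family (`x_k = 0`) and link family
  (`x_k = ½`) is available on the cubic torus exactly for EVEN sides `L ≥ 4`, along all axes, and
  the frame is then unique (`IsSiteFrame.eq_cubicAxisReflect`); together with
  `not_isTiltedFrame_cubicTorus` this is the complete list of frames of the cubic torus;
* `configReflect_cubicUnit_zero`, `configMidReflect_cubicUnit_zero` — along the time axis `0` the
  frame's two reflections of configurations ARE Wave 0's `GaugeConfig.negReflect` (`Θ'`, through
  sites, `ConstructiveQFTWave0SiteRPProofs`) and `GaugeConfig.timeReflect` (`Θ`, between slices,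
  `ConstructiveQFTWave0`): the lane's mechanism files and the tree's torus files speak of the same
  reflections;
* part 2 (`CubicTorusRP.lean`): site and link reflection positivity of the torus Wilson measure
  `wilsonMeasure ρ β` of `ConstructiveQFTWave0` along EVERY axis of the even torus `(ℤ/2Q)^d`,
  `Q ≥ 2`, as one-line instances of the lane's mechanism theorems.

What this module does NOT say. Frames are SUFFICIENT structures: the odd torus (`L = 2n + 1 ≥ 3`)
and the torus of side `2` carry no site frame (`not_isSiteFrame_cubicTorus_of_ne`), yet reflection
positivity in the mixed site/link pair of hyperplanes holds on the odd torus
(`wilsonExpectation_oddReflectionPositive`, Wave 0). Nothing here concerns infinite volume.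

References: K. Osterwalder, E. Seiler, Ann. Phys. 110 (1978) 440, §2; E. Seiler, LNP 159 (1982)
Ch. 2; J. Fröhlich, R. Israel, E. H. Lieb, B. Simon, Comm. Math. Phys. 62 (1978) 1, Thm. 2.1;
M. Lüscher, Comm. Math. Phys. 54 (1977) 283; I. Montvay, G. Münster, Quantum Fields on a Lattice
(1994) pp. 180–185 (site and link reflections of the periodic lattice, even period);
S. Friedli, Y. Velenik, Statistical Mechanics of Lattice Systems (2017) §10.3.1; V. Kazakov,
Z. Zheng, arXiv:2203.11360 §3.1 (the three reflection-positivity families of the bootstrap).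
-/

open Literature.MathematicalPhysics.QuantumFieldTheory (Site GaugeConfig)

namespace Summit.QuantumFields.GaugeBoot

namespace TiltedRP

/-! ## The coordinate reflection and the coordinate of the cubic torus -/

section Frame

variable (d L : ℕ) (k : Fin d)

/-- The unit vectors of the cubic torus, evaluated: `e_k m = [m = k]`. -/
theorem cubicUnit_apply (m : Fin d) : cubicUnit d L k m = if m = k then (1 : ZMod L) else 0 := by
  simp [cubicUnit, Pi.single_apply]

/-- **The site reflection `x_k ↦ -x_k` of the cubic torus `(ℤ/L)^d` along the axis `k`** (an
additive endomorphism of `Site d L`). -/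
def cubicAxisReflect : Site d L →+ Site d L where
  toFun x m := if m = k then -x m else x m
  map_zero' := by funext m; simp
  map_add' x y := by funext m; simp only [Pi.add_apply]; split_ifs <;> ring

/-- `cubicAxisReflect` evaluated. -/
@[simp] theorem cubicAxisReflect_apply (x : Site d L) (m : Fin d) :
    cubicAxisReflect d L k x m = if m = k then -x m else x m := rfl

/-- **The coordinate `x ↦ x_k` of the cubic torus** (an additive map `Site d L →+ ℤ/L`; for
`L = 2Q` it is the height of the site frame along `k`). -/
def cubicAxisCoord : Site d L →+ ZMod L := Pi.evalAddMonoidHom (fun _ : Fin d => ZMod L) k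

/-- `cubicAxisCoord` evaluated. -/
@[simp] theorem cubicAxisCoord_apply (x : Site d L) : cubicAxisCoord d L k x = x k := rfl

/-- The reflection reverses `e_k`. -/
theorem cubicAxisReflect_cubicUnit_self :
    cubicAxisReflect d L k (cubicUnit d L k) = -cubicUnit d L k := by
  funext m
  simp only [cubicAxisReflect_apply, Pi.neg_apply, cubicUnit_apply]
  split_ifs <;> simp

/-- The reflection fixes `e_l`, `l ≠ k`. -/
theorem cubicAxisReflect_cubicUnit_other {l : Fin d} (hl : l ≠ k) :
    cubicAxisReflect d L k (cubicUnit d L l) = cubicUnit d L l := by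
  funext m
  simp only [cubicAxisReflect_apply, cubicUnit_apply]
  by_cases hm : m = k
  · subst hm
    rw [if_pos rfl, if_neg (Ne.symm hl), neg_zero]
  · rw [if_neg hm]

/-- The reflection is an involution. -/
@[simp] theorem cubicAxisReflect_cubicAxisReflect (x : Site d L) :
    cubicAxisReflect d L k (cubicAxisReflect d L k x) = x := by
  funext m
  simp only [cubicAxisReflect_apply]
  split_ifs <;> simp

/-- The reflection reverses the coordinate. -/
theorem cubicAxisCoord_cubicAxisReflect (x : Site d L) :
    cubicAxisCoord d L k (cubicAxisReflect d L k x) = -cubicAxisCoord d L k x := by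
  simp

/-- **The layers `x_k = 0` and `x_k = Q` of the even torus `(ℤ/2Q)^d` are pointwise fixed by
`x_k ↦ -x_k`** (`-Q = Q` in `ℤ/2Q`). -/
theorem cubicAxisReflect_eq_self_of_layer {Q : ℕ} (x : Site d (2 * Q))
    (hx : x k = 0 ∨ x k = ((Q : ℕ) : ZMod (2 * Q))) : cubicAxisReflect d (2 * Q) k x = x := by
  funext m
  simp only [cubicAxisReflect_apply]
  by_cases hm : m = k
  · subst hm
    rw [if_pos rfl]
    rcases hx with h0 | hQ
    · rw [h0, neg_zero]
    · rw [hQ, neg_natCast_self]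
  · rw [if_neg hm]

/-- **The cubic torus of even side `L = 2Q ≥ 4` carries a site frame along EVERY axis `k`**:
reflection `x_k ↦ -x_k`, height `x ↦ x_k`. -/
theorem isSiteFrame_cubicTorus {Q : ℕ} (hQ : 2 ≤ Q) (k : Fin d) :
    IsSiteFrame (cubicUnit d (2 * Q)) k (cubicAxisReflect d (2 * Q) k) Q
      (cubicAxisCoord d (2 * Q) k) where
  two_le := hQ
  map_e_self := cubicAxisReflect_cubicUnit_self d (2 * Q) k
  map_e_other l hl := cubicAxisReflect_cubicUnit_other d (2 * Q) k hl
  invol := cubicAxisReflect_cubicAxisReflect d (2 * Q) k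
  height_self := by rw [cubicAxisCoord_apply, cubicUnit_apply, if_pos rfl]
  height_other l hl := by rw [cubicAxisCoord_apply, cubicUnit_apply, if_neg (Ne.symm hl)]
  height_map := cubicAxisCoord_cubicAxisReflect d (2 * Q) k
  fix_of_layer x hx := cubicAxisReflect_eq_self_of_layer d k x hx

end Frame

/-! ## Classification: which cubic tori carry a site frame, and uniqueness -/

section Classification

variable {d : ℕ}

/-- **CLASSIFICATION OF THE SITE FRAMES OF THE CUBIC TORUS.** `(ℤ/L)^d` (marked translations the unit
vectors) carries a site frame along the axis `k` with half period `Q` — for SOME additive reflection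
`σ` and SOME height `h` — if and only if `Q ≥ 2` and `L = 2Q`. Necessity: a frame forces
`addOrderOf e_k = 2Q` (`TiltedFrameNoGo.lean`: `2Q • e_k = 0`, and `n • e_k = 0 ⇒ 2Q ∣ n` with
`n = L`), while `e_k` has order `L`; sufficiency: `isSiteFrame_cubicTorus`. In particular the
Osterwalder–Seiler frame mechanism for the site (`x_k = 0`) and link (`x_k = ½`) families is
available on the cubic torus exactly for EVEN sides `L ≥ 4` — the "even `L`" proviso of the
reflection-positivity blocks of a torus bootstrap, read off intrinsically. -/
theorem exists_isSiteFrame_cubicTorus_iff (L : ℕ) (k : Fin d) (Q : ℕ) :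
    (∃ (σ : Site d L →+ Site d L) (h : Site d L →+ ZMod (2 * Q)),
        IsSiteFrame (cubicUnit d L) k σ Q h) ↔ 2 ≤ Q ∧ L = 2 * Q := by
  constructor
  · rintro ⟨σ, h, hS⟩
    refine ⟨hS.two_le, ?_⟩
    -- `L ∣ 2Q`: the `k`-th coordinate of `2Q • e_k = 0`
    have h1 : L ∣ 2 * Q := by
      have hh := congrFun hS.two_mul_nsmul_e_self k
      simp only [Pi.smul_apply, cubicUnit, Pi.single_eq_same, Pi.zero_apply, nsmul_eq_mul,
        mul_one] at hh
      exact (ZMod.natCast_eq_zero_iff _ _).1 hh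
    -- `2Q ∣ L`: `L • e_k = 0`
    have h2 : 2 * Q ∣ L := by
      refine hS.two_mul_dvd_of_nsmul_e_self ?_
      funext m
      simp only [Pi.smul_apply, Pi.zero_apply]
      rw [nsmul_eq_mul, ZMod.natCast_self, zero_mul]
    exact Nat.dvd_antisymm h1 h2
  · rintro ⟨hQ, rfl⟩
    exact ⟨_, _, isSiteFrame_cubicTorus d hQ k⟩

/-- The negative half in the usual form: **no site frame on a cubic torus of side `L ≠ 2Q`** — in
particular none on an odd torus and none on the torus of side `2` (there `Q = 1 < 2`), for any
reflection and any height. (Reflection positivity itself may survive without a frame: Wave 0's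
`wilsonExpectation_oddReflectionPositive` on the odd torus.) -/
theorem not_isSiteFrame_cubicTorus_of_ne {L Q : ℕ} (hL : L ≠ 2 * Q) (k : Fin d)
    (σ : Site d L →+ Site d L) (h : Site d L →+ ZMod (2 * Q)) :
    ¬ IsSiteFrame (cubicUnit d L) k σ Q h := fun hS =>
  hL ((exists_isSiteFrame_cubicTorus_iff L k Q).1 ⟨σ, h, hS⟩).2

/-- No site frame on a cubic torus of odd side. -/
theorem not_isSiteFrame_cubicTorus_odd {L Q : ℕ} (hL : Odd L) (k : Fin d)
    (σ : Site d L →+ Site d L) (h : Site d L →+ ZMod (2 * Q)) :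
    ¬ IsSiteFrame (cubicUnit d L) k σ Q h :=
  not_isSiteFrame_cubicTorus_of_ne (fun hL' => by
    rw [hL'] at hL
    exact (Nat.not_even_iff_odd.2 hL) (even_two_mul Q)) k σ h

/-- An element of `ℤ/L` placed on one axis is an integer multiple of the unit vector. -/
theorem single_eq_zsmul_cubicUnit (L : ℕ) (m : Fin d) (x : ZMod L) :
    (Pi.single m x : Site d L) = ((x.cast : ℤ)) • cubicUnit d L m := by
  funext l
  simp only [Pi.smul_apply, cubicUnit_apply, smul_ite, smul_zero, zsmul_eq_mul, mul_one,
    ZMod.intCast_zmod_cast]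
  by_cases hl : l = m
  · subst hl
    rw [Pi.single_eq_same, if_pos rfl]
  · rw [Pi.single_eq_of_ne hl, if_neg hl]

/-- **An additive map out of the cubic torus is determined by its values on the unit vectors.** -/
theorem addMonoidHom_ext_cubicUnit {L : ℕ} {M : Type*} [AddCommGroup M] {f g : Site d L →+ M}
    (hfg : ∀ m, f (cubicUnit d L m) = g (cubicUnit d L m)) : f = g := by
  refine AddMonoidHom.functions_ext _ _ _ fun m x => ?_
  rw [single_eq_zsmul_cubicUnit, map_zsmul, map_zsmul, hfg]

/-- **Uniqueness: every site frame of the cubic torus IS the coordinate frame** — its reflection is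
`x_k ↦ -x_k` and its height is `x ↦ x_k`. -/
theorem IsSiteFrame.eq_cubicAxisReflect {Q : ℕ} {k : Fin d}
    {σ : Site d (2 * Q) →+ Site d (2 * Q)} {h : Site d (2 * Q) →+ ZMod (2 * Q)}
    (hS : IsSiteFrame (cubicUnit d (2 * Q)) k σ Q h) :
    σ = cubicAxisReflect d (2 * Q) k ∧ h = cubicAxisCoord d (2 * Q) k := by
  have hS' := isSiteFrame_cubicTorus d hS.two_le k
  refine ⟨addMonoidHom_ext_cubicUnit fun m => ?_, addMonoidHom_ext_cubicUnit fun m => ?_⟩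
  · by_cases hm : m = k
    · subst hm
      rw [hS.map_e_self, hS'.map_e_self]
    · rw [hS.map_e_other m hm, hS'.map_e_other m hm]
  · by_cases hm : m = k
    · subst hm
      rw [hS.height_self, hS'.height_self]
    · rw [hS.height_other m hm, hS'.height_other m hm]

end Classification

/-! ## Along the time axis the frame reflections are Wave 0's `Θ'` and `Θ` -/

section WaveZero

variable {d : ℕ} [NeZero d] (L : ℕ)

/-- The frame's site reflection along axis `0` is Wave 0's `θ' : t ↦ -t`. -/
theorem cubicAxisReflect_zero_eq_negReflect (x : Site d L) :
    cubicAxisReflect d L 0 x = x.negReflect := by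
  funext m
  by_cases hm : m = 0
  · subst hm
    rw [cubicAxisReflect_apply, if_pos rfl,
      Literature.MathematicalPhysics.QuantumFieldTheory.Site.negReflect, Function.update_self]
  · rw [cubicAxisReflect_apply, if_neg hm,
      Literature.MathematicalPhysics.QuantumFieldTheory.Site.negReflect, Function.update_of_ne hm]

/-- The frame's mid-plane reflection along axis `0` is Wave 0's `θ : t ↦ 1 - t`. -/
theorem midReflect_cubicUnit_zero_eq_timeReflect (x : Site d L) :
    midReflect (cubicUnit d L) 0 (cubicAxisReflect d L 0) x = x.timeReflect := by
  funext m
  unfold midReflect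
  by_cases hm : m = 0
  · subst hm
    rw [Pi.add_apply, cubicAxisReflect_apply, if_pos rfl, cubicUnit, Pi.single_eq_same,
      Literature.MathematicalPhysics.QuantumFieldTheory.Site.timeReflect, Function.update_self]
    ring
  · rw [Pi.add_apply, cubicAxisReflect_apply, if_neg hm, cubicUnit, Pi.single_eq_of_ne hm, add_zero,
      Literature.MathematicalPhysics.QuantumFieldTheory.Site.timeReflect, Function.update_of_ne hm]

/-- `σ x - e_0 = θ'(x + e_0)`: the base point of the reversed time link. -/
theorem cubicAxisReflect_zero_sub_cubicUnit (x : Site d L) :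
    cubicAxisReflect d L 0 x - cubicUnit d L 0 = (x.shift 0).negReflect := by
  funext m
  unfold Literature.MathematicalPhysics.QuantumFieldTheory.Site.negReflect
    Literature.MathematicalPhysics.QuantumFieldTheory.Site.shift
  by_cases hm : m = 0
  · subst hm
    rw [Pi.sub_apply, cubicAxisReflect_apply, if_pos rfl, cubicUnit, Pi.single_eq_same,
      Function.update_self, Pi.add_apply, Pi.single_eq_same]
    ring
  · rw [Pi.sub_apply, cubicAxisReflect_apply, if_neg hm, cubicUnit, Pi.single_eq_of_ne hm, sub_zero,
      Function.update_of_ne hm, Pi.add_apply, Pi.single_eq_of_ne hm, add_zero]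

/-- `σ x = θ(x + e_0)`: the base point of the reversed time link of the mid-plane reflection. -/
theorem cubicAxisReflect_zero_eq_timeReflect_shift (x : Site d L) :
    cubicAxisReflect d L 0 x = (x.shift 0).timeReflect := by
  funext m
  unfold Literature.MathematicalPhysics.QuantumFieldTheory.Site.timeReflect
    Literature.MathematicalPhysics.QuantumFieldTheory.Site.shift
  by_cases hm : m = 0
  · subst hm
    rw [cubicAxisReflect_apply, if_pos rfl, Function.update_self, Pi.add_apply, Pi.single_eq_same]
    ring
  · rw [cubicAxisReflect_apply, if_neg hm, Function.update_of_ne hm, Pi.add_apply,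
      Pi.single_eq_of_ne hm, add_zero]

/-- **Along the time axis the frame's site reflection of configurations is Wave 0's `Θ'`**
(`GaugeConfig.negReflect` of `ConstructiveQFTWave0SiteRPProofs`: spatial links carried along, the
time link `x → x + e_0` sent to the reversed link `θ'(x + e_0) → θ' x` with the inverse). -/
theorem configReflect_cubicUnit_zero {G : Type*} [Group G] (U : GaugeConfig d L G) :
    configReflect (cubicUnit d L) 0 (cubicAxisReflect d L 0) U = U.negReflect := by
  funext l
  obtain ⟨x, m⟩ := l
  by_cases hm : m = 0
  · subst hm
    rw [configReflect_self, cubicAxisReflect_zero_sub_cubicUnit]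
    exact (if_pos rfl).symm
  · rw [configReflect_other _ _ _ _ _ hm, cubicAxisReflect_zero_eq_negReflect]
    exact (if_neg hm).symm

/-- **Along the time axis the frame's mid-plane reflection of configurations is Wave 0's `Θ`**
(`GaugeConfig.timeReflect` of `ConstructiveQFTWave0`). -/
theorem configMidReflect_cubicUnit_zero {G : Type*} [Group G] (U : GaugeConfig d L G) :
    configMidReflect (cubicUnit d L) 0 (cubicAxisReflect d L 0) U = U.timeReflect := by
  funext l
  obtain ⟨x, m⟩ := l
  by_cases hm : m = 0
  · subst hm
    rw [configMidReflect_self, cubicAxisReflect_zero_eq_timeReflect_shift]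
    exact (if_pos rfl).symm
  · rw [configMidReflect_other _ _ _ _ _ hm, midReflect_cubicUnit_zero_eq_timeReflect]
    exact (if_neg hm).symm

end WaveZero

end TiltedRP

end Summit.QuantumFields.GaugeBoot
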